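import Summits.Ventures.QEC.CircuitDistance.SchedFamilyCeiling01
import Summits.Ventures.QEC.CircuitDistance.SchedFamilyCeiling02
import Summits.Ventures.QEC.CircuitDistance.SchedFamilyCeiling03
import Summits.Ventures.QEC.CircuitDistance.SchedFamilyCeiling04
import Summits.Ventures.QEC.CircuitDistance.SchedFamilyCeiling05
import Summits.Ventures.QEC.CircuitDistance.SchedFamilyCeiling06
import Summits.Ventures.QEC.CircuitDistance.SchedFamilyCeiling07
import Summits.Ventures.QEC.CircuitDistance.SchedFamilyCeiling08
import Summits.Ventures.QEC.CircuitDistance.SchedFamilyCeiling09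
import Summits.Ventures.QEC.CircuitDistance.SchedFamilyCeiling10
import Summits.Ventures.QEC.CircuitDistance.SchedFamilyCeiling11
import Summits.Ventures.QEC.CircuitDistance.SchedFamilyCeiling12
import Summits.Ventures.QEC.CircuitDistance.SchedFamily936
import HarnessLib

/-!
# `[[144,12,12]]` — THE FAMILY CEILING, list form: `circuitDistanceₛ σ bb144SM Nc ≤ 11` for every `σ ∈ SMSchedule.family936`, `Nc ≥ 1`
# (venture QEC, experiment cell CDX; binder of the chunk files `SchedFamilyCeiling01–12` against idea-2 g4's list `SMSchedule.family936`;
# UPPER side only — nothing here asserts a value of `d_circ`)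

Provenance: data qec-cdx-idea-2 g3 (CARD-H) / list g4 (CARD-I, `SchedFamily936`); typed by qec-cdx-type-1 g4 (2026-08-29); landing per
director-qec R169 (3). WHAT THIS FILE PROVES.
* `Family144.certs936 = certs01 ++ … ++ certs12` and `Family144.certs936_map_sched : certs936.map FamilyCert.sched = SMSchedule.family936`
  (`rfl`: the schedule column IS idea-2's list, entry for entry, in the cell's numbering — RIDER L); `Family144.certs936_length = 936`;
* `Family144.certs936_check` (conjunction of the 12 chunk kernel facts) ⇒ `SMSchedule.family936_hasAt_length` (every listed order has a
  one-cycle undetectable logical set of its row's weight ∈ {6, 8, 9, 10, 11}), `SMSchedule.family936_hasAt` (… of weight `≤ 11`) and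
  ★ `SMSchedule.family936_circuitDistanceₛ_le : ∀ σ ∈ family936, ∀ Nc ≥ 1, circuitDistanceₛ σ bb144SM Nc ≤ 11` and its `Nc = 1`
  instance under the R181 (2)(c) name `family936_circuitDistance_one_le_eleven`.
The `∀ σ, σ.Valid → …` form waits for the completeness module `SchedFamily936Complete` (`SchedFamilyCeilingValid`). IN MODEL (spec semantics
of `SyndromeCycle`/`SMSchedule`, criterion O1); RIDER L and EXT travel with any use; wording is the director's. Nothing here changes a deployed code.
-/

namespace Summit.Ventures.QEC.CircuitDistance

namespace Family144

/-- All 936 certificate rows, in the cell's numbering (`orders936.json`). -/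
def certs936 : List FamilyCert := certs01 ++ certs02 ++ certs03 ++ certs04 ++ certs05 ++ certs06 ++ certs07 ++ certs08 ++ certs09 ++ certs10 ++ certs11 ++ certs12

set_option maxRecDepth 8192 in
/-- The schedule column of `certs936` IS idea-2's `SMSchedule.family936`, entry for entry (`rfl`; the 936-step definitional
unfolding needs `maxRecDepth` above the default 512 — crit-1 g4 RFL936probe cd4ae9387e3eba8f). -/
theorem certs936_map_sched : certs936.map FamilyCert.sched = SMSchedule.family936 := by
  rfl

/-- `certs936` has 936 rows. -/
theorem certs936_length : certs936.length = 936 := by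
  rw [← List.length_map (f := FamilyCert.sched), certs936_map_sched, SMSchedule.family936_length]

/-- All 936 rows pass `FamilyCert.check` (the 12 chunk kernel facts). -/
theorem certs936_check : (certs936.all FamilyCert.check) = true := by
  simp only [certs936, List.all_append, Bool.and_eq_true]
  exact ⟨⟨⟨⟨⟨⟨⟨⟨⟨⟨⟨certs01_check, certs02_check⟩, certs03_check⟩, certs04_check⟩, certs05_check⟩, certs06_check⟩, certs07_check⟩, certs08_check⟩, certs09_check⟩, certs10_check⟩, certs11_check⟩, certs12_check⟩

end Family144

namespace SMSchedule

open Family144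

/-- Every order of `family936` is the schedule of a passing certificate row. -/
theorem exists_cert_of_mem_family936 {σ : SMSchedule} (hσ : σ ∈ family936) :
    ∃ c ∈ certs936, c.sched = σ ∧ c.check = true := by
  rw [← certs936_map_sched] at hσ
  obtain ⟨c, hc, rfl⟩ := List.mem_map.1 hσ
  exact ⟨c, hc, rfl, List.all_eq_true.1 certs936_check c hc⟩

/-- Every order of `family936` has a ONE-cycle undetectable logical fault set of weight `≤ 11`. -/
theorem family936_hasAt : ∀ σ ∈ family936, HasLogicalFaultOfWeightAtMostAtₛ σ bb144SM 1 11 := by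
  intro σ hσ
  obtain ⟨c, _, rfl, h⟩ := exists_cert_of_mem_family936 hσ
  exact Gen.hasLogicalFaultOfWeightAtMostAt_mono (FamilyCert.length_le_of_check c h) (FamilyCert.hasAt_of_check c h)

/-- … hence one of weight `≤ 11` in the `Nc`-cycle circuit for every `Nc ≥ 1`. -/
theorem family936_hasAt_all : ∀ σ ∈ family936, ∀ Nc : ℕ, 1 ≤ Nc → HasLogicalFaultOfWeightAtMostAtₛ σ bb144SM Nc 11 :=
  fun σ hσ => hasAtₛ_of_one σ bb144SM 11 (family936_hasAt σ hσ)

/-- ★ LIST FORM OF THE FAMILY CEILING: `circuitDistanceₛ σ bb144SM Nc ≤ 11` for every `σ ∈ family936` and every `Nc ≥ 1`. -/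
theorem family936_circuitDistanceₛ_le : ∀ σ ∈ family936, ∀ Nc : ℕ, 1 ≤ Nc → circuitDistanceₛ σ bb144SM Nc ≤ 11 := by
  rw [← certs936_map_sched]
  exact FamilyCert.forall_sched_le_of_all certs936_check

end SMSchedule

/-- ★ R181 (2)(c) NAME, one cycle: `∀ σ ∈ SMSchedule.family936, circuitDistanceₛ σ bb144SM 1 ≤ 11` (the `Nc = 1` instance of
`SMSchedule.family936_circuitDistanceₛ_le`). -/
theorem family936_circuitDistance_one_le_eleven : ∀ σ ∈ SMSchedule.family936, circuitDistanceₛ σ bb144SM 1 ≤ 11 :=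
  fun σ hσ => SMSchedule.family936_circuitDistanceₛ_le σ hσ 1 le_rfl

end Summit.Ventures.QEC.CircuitDistance
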